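import Summits.Ventures.KdS.RouteWDoublyResonantDictionary
import Summits.Ventures.KdS.RouteWDoublyResonantTruncation
import Summits.Ventures.KdS.RouteWDoublyResonantRecurrence
import Summits.Ventures.KdS.RouteWDoublyResonantHomotopy
import HarnessLib

/-!
# Venture KdS — the doubly-resonant candidates, VI: assembly — STRUCTURE §8 Q3/Q3′ in the kernel

HONEST FRAMING (venture `Summits/Ventures/KdS`, cell `pub-kds`; glue over
`RouteWDoublyResonantComparison` (Lemma A, p372130), `…Vieta` (Lemma B, p372467), `…Dictionary`
(tree-side glue, p374386), `…Truncation` ((1.1) in Lemma A's class, p374575), `…Recurrence`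
(polynomial solutions obey the rows of (1.1), p374717), `…Homotopy` (F-homotopy and Hatsuda's
connection problem, p374859)). The doubly-resonant POLYNOMIAL CANDIDATES of P1 g7 / LIT-1 g22 /
T10: subextremal Kerr–de Sitter, `m = 0`, `ω = iy` with `y = u·κ_c = (s − 1 − i₀)·κ₊` (`u > 0`,
`i₀ ∈ ℕ`), degree `d = s − 2 − i₀ − u ∈ ℕ`, a polynomial `Σ_{k≤d} c_k x^k ≢ 0` solving the
F-homotoped Heun equation `Hn(z_r; s+1+u b_n, −d; 2+i₀, s+u+1, 1−s+u b_n; q′)` on `(0, 1)`, and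
`λ` with `heunV(λ) = q′ + (u b_n − s)(2 + i₀)`. This file proves:
* `truncMatrix_row_sum`, `truncMatrix_eigRel_of_isSolutionOn`: the coefficient vector is an
  eigenvector of T10's matrix (1.1) with eigenvalue `q′`; hence (`re_lambdaBar_neg_of_candidate`,
  Lemma A + Dictionary) `Re λ̄ < 0` and (`im_lambdaBar_mul_conj_pos_of_candidate`) the angular
  half-line hypothesis `Im(λ̄ω̄) ≤ 0` of `RouteW.NonExtremeStrata` FAILS;
* `heunSigmaMinus_of_resonance` (`σ₋ = 2 + i₀ + u − u b_n` from `Σ_h B(r_h) = 0`),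
  `hasHeunConnectionSolution_of_candidate`: `y = (z_r − x)^{u b_n − s}·Σ c_k x^k` is a non-trivial
  solution of Hatsuda's connection problem at `(iy, 0, λ)`, hence
  (`radial_of_hasHeunConnectionSolution`, tree `KerrDeSitterHeunEquivalence`) a non-trivial
  classical radial Teukolsky solution on `(r₊, r_c)`, ingoing at `𝓗⁺`, outgoing at `𝓗⁺_c`, with
  `Im ω = y > 0`;
* ★ `doublyResonant_candidate_summary`: both at once — these `Im ω > 0` radial solutions (boundary
  behaviour in the sense of the tree's generic-bullet predicates, Def. 3.3 AS TYPED) exist and are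
  excluded from `NonExtremeStrata`'s hypotheses by the angular sign condition ONLY
  (STRUCTURE §8 Q3: "excluded ONLY by the angular-side sign condition" — now a kernel statement).
* `not_isAngularEigenvalue_of_candidate`: for `a > 0` and integral `s` (admissibility of `m = 0`)
  such `λ` is never an angular eigenvalue (the tree's proved `…angularSign_holds`), so the radial
  solutions of (1) are never Teukolsky MODE solutions.
Nothing here is a statement about `NonExtremeStrata` itself, H3, or the Final State Conjecture.
0 cited facts, no `sorry`.
-/

noncomputable section

open Set Complex Finset

namespace Summit.Ventures.KdS.RouteW.DoublyResonant

open Literature.Analysis.ODE Literature.Analysis.ODE.GeneralHeun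
open Literature.Geometry.Lorentzian Literature.Geometry.Lorentzian.KerrDeSitter

/-- **Rows of (1.1) as a finite sum.** For `c : ℕ → ℂ` and `i ≤ d`:
`Σ_j A_{ij} c_j = D_i c_i − t(i+1)(i+γ)·[i+1 ≤ d]c_{i+1} + [i ≥ 1](i−1+α′)(d−(i−1))c_{i−1}`. -/
theorem truncMatrix_row_sum (t γ δ ε' α' : ℝ) (d : ℕ) (c : ℕ → ℂ) (i : Fin (d + 1)) :
    ∑ j : Fin (d + 1), (truncMatrix t γ δ ε' α' d i j : ℂ) * c j =
      (truncDiag t γ δ ε' i : ℂ) * c i +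
        (if (i : ℕ) + 1 < d + 1 then (-(t * ((i : ℝ) + 1) * ((i : ℝ) + γ)) : ℂ) * c (i + 1)
          else 0) +
        (if (i : ℕ) = 0 then 0
          else ((((i : ℕ) - 1 : ℕ) : ℝ) + α' : ℂ) * ((d : ℝ) - (((i : ℕ) - 1 : ℕ) : ℝ) : ℂ) *
            c ((i : ℕ) - 1)) := by
  -- pass to a sum over `range (d+1)` of a function of the natural-number index
  set F : ℕ → ℂ := fun n =>
    (if n = (i : ℕ) then (truncDiag t γ δ ε' i : ℂ) * c n else 0) +
      (if n = (i : ℕ) + 1 then (-(t * ((i : ℝ) + 1) * ((i : ℝ) + γ)) : ℂ) * c n else 0) +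
      (if (i : ℕ) = n + 1 then (((n : ℝ) + α' : ℝ) : ℂ) * (((d : ℝ) - n : ℝ) : ℂ) * c n else 0)
    with hF
  have hsum : ∑ j : Fin (d + 1), (truncMatrix t γ δ ε' α' d i j : ℂ) * c j =
      ∑ n ∈ range (d + 1), F n := by
    rw [← Fin.sum_univ_eq_sum_range]
    refine Finset.sum_congr rfl fun j _ => ?_
    simp only [hF, truncMatrix]
    split_ifs <;> first | (exfalso; omega) | (push_cast; ring)
  rw [hsum, hF, sum_add_distrib, sum_add_distrib]
  -- the three indicator sums
  have h1 : ∑ n ∈ range (d + 1), (if n = (i : ℕ) then (truncDiag t γ δ ε' i : ℂ) * c n else 0) =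
      (truncDiag t γ δ ε' i : ℂ) * c i := by
    rw [sum_ite_eq' (range (d + 1)) (i : ℕ), if_pos (Finset.mem_range.2 i.2)]
  have h2 : ∑ n ∈ range (d + 1),
      (if n = (i : ℕ) + 1 then (-(t * ((i : ℝ) + 1) * ((i : ℝ) + γ)) : ℂ) * c n else 0) =
      (if (i : ℕ) + 1 < d + 1 then (-(t * ((i : ℝ) + 1) * ((i : ℝ) + γ)) : ℂ) * c (i + 1)
        else 0) := by
    rw [sum_ite_eq' (range (d + 1)) ((i : ℕ) + 1)]
    simp only [Finset.mem_range]
  have h3 : ∑ n ∈ range (d + 1),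
      (if (i : ℕ) = n + 1 then (((n : ℝ) + α' : ℝ) : ℂ) * (((d : ℝ) - n : ℝ) : ℂ) * c n else 0) =
      (if (i : ℕ) = 0 then 0
        else ((((i : ℕ) - 1 : ℕ) : ℝ) + α' : ℂ) * ((d : ℝ) - (((i : ℕ) - 1 : ℕ) : ℝ) : ℂ) *
          c ((i : ℕ) - 1)) := by
    by_cases hi : (i : ℕ) = 0
    · rw [if_pos hi]
      exact sum_eq_zero fun n _ => by rw [if_neg (by omega)]
    · rw [if_neg hi]
      have hmem : (i : ℕ) - 1 ∈ range (d + 1) := Finset.mem_range.2 (by omega)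
      have hcongr : ∀ n ∈ range (d + 1),
          (if (i : ℕ) = n + 1 then (((n : ℝ) + α' : ℝ) : ℂ) * (((d : ℝ) - n : ℝ) : ℂ) * c n
            else 0) =
          (if n = (i : ℕ) - 1 then (((n : ℝ) + α' : ℝ) : ℂ) * (((d : ℝ) - n : ℝ) : ℂ) * c n
            else 0) := fun n _ => by
        by_cases h : (i : ℕ) = n + 1
        · rw [if_pos h, if_pos (by omega)]
        · rw [if_neg h, if_neg (by omega)]
      rw [sum_congr rfl hcongr, sum_ite_eq' (range (d + 1)) ((i : ℕ) - 1), if_pos hmem]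
      push_cast
      ring
  rw [h1, h2, h3]


/-- **Polynomial solutions are eigenvectors of (1.1)** (`heun_truncation_rows` read through
`truncMatrix_row_sum`): if `Σ_{k≤d} c_k x^k` solves `Hn(t; α′, −d; γ, δ, ε′; q)` on a real interval
(real `t, α′, γ, δ, ε′`, Fuchs relation), then `Σ_j A_{ij} c_j = q c_i` for the matrix (1.1). -/
theorem truncMatrix_eigRel_of_isSolutionOn {t γ δ ε' α' : ℝ} {q : ℂ} {c : ℕ → ℂ} {d : ℕ}
    {a b : ℝ} (hab : a < b) (hF : (γ : ℂ) + δ + ε' = α' + -(d : ℂ) + 1)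
    (hc : ∀ k, d + 1 ≤ k → c k = 0)
    (hsol : IsSolutionOn (t : ℂ) (α' : ℂ) (-(d : ℂ)) γ δ ε' q (Ioo a b) (powSum c (d + 1))) :
    ∀ i : Fin (d + 1), ∑ j, (truncMatrix t γ δ ε' α' d i j : ℂ) * c j = q * c i := by
  intro i
  have hi := i.2
  have hrow := heun_truncation_rows (n := (i : ℕ)) hab hF rfl hc hsol (by omega)
  rw [truncMatrix_row_sum, hrow]
  have hD : diagD (t : ℂ) (γ : ℂ) (δ : ℂ) (ε' : ℂ) (i : ℕ) =
      ((truncDiag t γ δ ε' (i : ℕ) : ℝ) : ℂ) := by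
    unfold diagD truncDiag; push_cast; ring
  rw [hD]
  congr 1
  · by_cases hlt : (i : ℕ) + 1 < d + 1
    · rw [if_pos hlt]; push_cast; ring
    · rw [if_neg hlt, hc ((i : ℕ) + 1) (by omega)]; ring
  · by_cases h0 : (i : ℕ) = 0
    · rw [if_pos h0, if_pos h0]
    · rw [if_neg h0, if_neg h0]
      have hcast : (((i : ℕ) - 1 : ℕ) : ℂ) = ((i : ℕ) : ℂ) - 1 := by
        rw [Nat.cast_sub (by omega)]; push_cast; ring
      push_cast
      rw [hcast]

/-- ★ **T10's theorem for the polynomial family (assembled).** On subextremal Kerr–de Sitter with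
`a ≠ 0`, at `m = 0`, `ω = iy` on a doubly-resonant stratum (`y = u·κ_c = (s−1−i₀)·κ₊`, `u > 0`,
`i₀ ≥ 0`, degree `d = s − 2 − i₀ − u`), every nonzero polynomial `Σ_{k≤d} c_k x^k` solving
`Hn(z_r; s+1+u b_n, −d; 2+i₀, s+u+1, 1−s+u b_n; q′)` on a real interval and every `λ` with
`heunV(λ) = q′ + (u b_n − s)(2+i₀)` give `Re λ̄ < 0` (Lemma A on (1.1) ⇒ `0 ≤ Re q′`; then the
Dictionary's `re_lambdaBar_neg_of_re_nonneg`). -/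
theorem re_lambdaBar_neg_of_candidate {M a Λ : ℝ} (hsub : IsSubextremal M a Λ) (ha : a ≠ 0)
    {s u i₀ y : ℝ} {d : ℕ} (hu : 0 < u) (hi : 0 ≤ i₀)
    (hyc : y = u * surfaceGravity M a Λ (rCosmo M a Λ))
    (hyp : y = (s - 1 - i₀) * surfaceGravity M a Λ (rPlus M a Λ)) (hd : (d : ℝ) = s - 2 - i₀ - u)
    {c : ℕ → ℂ} (hc : ∀ k, d + 1 ≤ k → c k = 0) (hc0 : ∃ k, c k ≠ 0) {q : ℂ} {x₁ x₂ : ℝ}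
    (hx : x₁ < x₂)
    (hsol : IsSolutionOn (mobiusZr M a Λ : ℂ) ((s + 1 + u * bNeg M a Λ : ℝ) : ℂ) (-(d : ℂ))
      ((2 + i₀ : ℝ) : ℂ) ((s + u + 1 : ℝ) : ℂ) ((1 - s + u * bNeg M a Λ : ℝ) : ℂ) q (Ioo x₁ x₂)
      (powSum c (d + 1)))
    {lam : ℂ} (hV : heunV M a Λ s (I * y) 0 lam = q + (((u * bNeg M a Λ - s) * (2 + i₀) : ℝ) : ℂ)) :
    (lambdaBar a Λ s (I * y) 0 lam).re < 0 := by
  have hκp := surfaceGravity_rPlus_pos hsub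
  have hκc := surfaceGravity_rCosmo_pos hsub
  have hs : 0 ≤ s := by
    have hy : 0 < y := by rw [hyc]; positivity
    rw [hyp] at hy
    have h1 : 0 < s - 1 - i₀ := (pos_iff_pos_of_mul_pos hy).2 hκp
    linarith
  have ht := one_lt_mobiusZr hsub
  have hb := bNeg_pos hsub
  have hv : (fun j : Fin (d + 1) => c j) ≠ 0 := by
    obtain ⟨k, hk⟩ := hc0
    have hkd : k < d + 1 := by
      by_contra h
      exact hk (hc k (by omega))
    intro h0
    exact hk (by simpa using congrFun h0 ⟨k, hkd⟩)
  have hF : (((2 + i₀ : ℝ) : ℂ)) + ((s + u + 1 : ℝ) : ℂ) + ((1 - s + u * bNeg M a Λ : ℝ) : ℂ) =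
      ((s + 1 + u * bNeg M a Λ : ℝ) : ℂ) + -(d : ℂ) + 1 := by
    have hd' : (d : ℂ) = ((s - 2 - i₀ - u : ℝ) : ℂ) := by
      rw [← hd]; push_cast; rfl
    rw [hd']; push_cast; ring
  have heig := truncMatrix_eigRel_of_isSolutionOn hx hF hc hsol
  have hq : 0 ≤ q.re := truncMatrixT10_eigenvalue_re_nonneg ht hs hu hb hi hv heig
  exact re_lambdaBar_neg_of_re_nonneg hsub ha hu hi hyc hyp hq hV

/-- **Corollary in the language of `RouteW.NonExtremeStrata`.** Under the same hypotheses, with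
`y > 0` (automatic: `y = u·κ_c`), the angular half-line hypothesis `Im(λ̄·ω̄) ≤ 0` FAILS at
`ω = iy`: `Im(λ̄·ω̄) = −y·Re λ̄ > 0`. So no polynomial candidate is a counterexample to
`NonExtremeStrata` as typed (T10 §5, first bullet). -/
theorem im_lambdaBar_mul_conj_pos_of_candidate {M a Λ : ℝ} (hsub : IsSubextremal M a Λ)
    (ha : a ≠ 0) {s u i₀ y : ℝ} {d : ℕ} (hu : 0 < u) (hi : 0 ≤ i₀)
    (hyc : y = u * surfaceGravity M a Λ (rCosmo M a Λ))
    (hyp : y = (s - 1 - i₀) * surfaceGravity M a Λ (rPlus M a Λ)) (hd : (d : ℝ) = s - 2 - i₀ - u)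
    {c : ℕ → ℂ} (hc : ∀ k, d + 1 ≤ k → c k = 0) (hc0 : ∃ k, c k ≠ 0) {q : ℂ} {x₁ x₂ : ℝ}
    (hx : x₁ < x₂)
    (hsol : IsSolutionOn (mobiusZr M a Λ : ℂ) ((s + 1 + u * bNeg M a Λ : ℝ) : ℂ) (-(d : ℂ))
      ((2 + i₀ : ℝ) : ℂ) ((s + u + 1 : ℝ) : ℂ) ((1 - s + u * bNeg M a Λ : ℝ) : ℂ) q (Ioo x₁ x₂)
      (powSum c (d + 1)))
    {lam : ℂ} (hV : heunV M a Λ s (I * y) 0 lam = q + (((u * bNeg M a Λ - s) * (2 + i₀) : ℝ) : ℂ)) :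
    0 < (lambdaBar a Λ s (I * y) 0 lam * (starRingEnd ℂ) (I * y)).im := by
  have h := re_lambdaBar_neg_of_candidate hsub ha hu hi hyc hyp hd hc hc0 hx hsol hV
  have hy : 0 < y := by rw [hyc]; exact mul_pos hu (surfaceGravity_rCosmo_pos hsub)
  have e : (lambdaBar a Λ s (I * y) 0 lam * (starRingEnd ℂ) (I * y)).im =
      -y * (lambdaBar a Λ s (I * y) 0 lam).re := by
    simp [Complex.mul_im, Complex.mul_re, Complex.I_re, Complex.I_im, Complex.ofReal_re,
      Complex.ofReal_im]
    ring
  rw [e]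
  nlinarith

/-! ### The existence half: the candidates ARE radial solutions with mode boundary behaviour -/

/-- `2B(r₋) = (s − 1 − i₀) − u + u·b_n` on a doubly-resonant stratum (`Σ_h B(r_h) = 0`). -/
theorem two_horizonB_rMinus_of_resonance {M a Λ : ℝ} (hsub : IsSubextremal M a Λ) {s u i₀ y : ℝ}
    (hyc : y = u * surfaceGravity M a Λ (rCosmo M a Λ))
    (hyp : y = (s - 1 - i₀) * surfaceGravity M a Λ (rPlus M a Λ)) :
    2 * horizonB M a Λ (I * y) 0 (rMinus M a Λ) = ((s - 1 - i₀ - u + u * bNeg M a Λ : ℝ) : ℂ) := by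
  have hsum := horizonB_sum hsub (I * y) 0
  have h1 := two_horizonB_rPlus hsub y
  have h2 := two_horizonB_rCosmo hsub y
  have h3 := two_horizonB_rNeg hsub y
  have hκp := (surfaceGravity_rPlus_pos hsub).ne'
  have hκc := (surfaceGravity_rCosmo_pos hsub).ne'
  have e1 : y / surfaceGravity M a Λ (rPlus M a Λ) = s - 1 - i₀ := by
    rw [hyp, mul_div_cancel_right₀ _ hκp]
  have e2 : y / surfaceGravity M a Λ (rCosmo M a Λ) = u := by
    rw [hyc, mul_div_cancel_right₀ _ hκc]
  rw [e1] at h1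
  rw [e2] at h2 h3
  push_cast at h1 h2 h3 ⊢
  linear_combination (2 : ℂ) * hsum - h1 - h2 - h3

/-- `σ₋ = 2 + i₀ + u − u·b_n` on a doubly-resonant stratum. -/
theorem heunSigmaMinus_of_resonance {M a Λ : ℝ} (hsub : IsSubextremal M a Λ) {s u i₀ y : ℝ}
    (hyc : y = u * surfaceGravity M a Λ (rCosmo M a Λ))
    (hyp : y = (s - 1 - i₀) * surfaceGravity M a Λ (rPlus M a Λ)) :
    heunSigmaMinus M a Λ s (I * y) 0 = ((2 + i₀ + u - u * bNeg M a Λ : ℝ) : ℂ) := by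
  unfold heunSigmaMinus
  rw [two_horizonB_rMinus_of_resonance hsub hyc hyp]
  push_cast
  ring

/-- A non-trivial solution of Hatsuda's connection problem gives a non-trivial classical radial
Teukolsky solution on `(r₊, r_c)` with the mode boundary behaviour at both horizons (the tree's
`isModeSolution_of_hasHeunConnectionSolution` without its angular-eigenvalue clause). -/
theorem radial_of_hasHeunConnectionSolution {M a Λ : ℝ} (hsub : IsSubextremal M a Λ) {s : ℝ}
    {ω : ℂ} {m : ℝ} {lam : ℂ} (hy : HasHeunConnectionSolution M a Λ s ω m lam) :
    ∃ R : ℝ → ℂ, IsRadialTeukolskySolution M a Λ s ω m lam R ∧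
      IsIngoingAtEventHorizon M a Λ s ω m R ∧ IsOutgoingAtCosmoHorizon M a Λ ω m R ∧
      ∃ r ∈ Ioo (rPlus M a Λ) (rCosmo M a Λ), R r ≠ 0 := by
  obtain ⟨y, hsol, h0, h1, x₀, hx₀, hy₀⟩ := hy
  refine ⟨fun r => heunWeight M a Λ s ω m r * y (mobiusZ M a Λ r),
    isRadialTeukolskySolution_of_heunSolution hsub hsol,
    isIngoingAtEventHorizon_of_heun_branch_at_zero hsub s ω m h0,
    isOutgoingAtCosmoHorizon_of_heun_smooth_at_one hsub s ω m h1,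
    mobiusInv M a Λ x₀, mobiusInv_mem_Ioo hsub hx₀, ?_⟩
  have hxinf : x₀ ≠ mobiusZinf M a Λ := ne_of_lt (hx₀.2.trans (one_lt_mobiusZinf hsub))
  beta_reduce
  rw [mobiusZ_mobiusInv hsub hxinf]
  exact mul_ne_zero (heunWeight_ne_zero hsub s ω m (mobiusInv_mem_Ioo hsub hx₀)) hy₀

/-- Polynomials are smooth. -/
theorem contDiff_powSum (c : ℕ → ℂ) (K : ℕ) :
    ContDiff ℝ ((⊤ : ℕ∞) : WithTop ℕ∞) (powSum c K) := by
  unfold powSum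
  exact ContDiff.sum fun k _ => contDiff_const.mul (Complex.ofRealCLM.contDiff.pow k)

/-- A polynomial with a non-zero coefficient does not vanish identically on `(0, 1)`. -/
theorem exists_powSum_ne_zero {c : ℕ → ℂ} {d : ℕ} (hc : ∀ k, d + 1 ≤ k → c k = 0)
    (hc0 : ∃ k, c k ≠ 0) : ∃ x ∈ Ioo (0 : ℝ) 1, powSum c (d + 1) x ≠ 0 := by
  by_contra h
  simp only [not_exists, not_and, not_not] at h
  obtain ⟨k, hk⟩ := hc0
  have hkd : k < d + 1 := by
    by_contra h'
    exact hk (hc k (by omega))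
  exact hk (Summit.Ventures.KdS.SpinFlipTS.coeff_eq_zero_of_sum_eval_eq_zero one_pos h k hkd)

/-- ★ **The doubly-resonant polynomial candidates solve Hatsuda's connection problem.** On
subextremal Kerr–de Sitter (`a ≠ 0` not needed here), at `m = 0`, `ω = iy` on a doubly-resonant
stratum (`y = u·κ_c = (s − 1 − i₀)·κ₊`, `i₀ ∈ ℕ`, degree `d = s − 2 − i₀ − u ∈ ℕ`): every nonzero
polynomial `Σ_{k≤d} c_k x^k` solving `Hn(z_r; s+1+u b_n, −d; 2+i₀, s+u+1, 1−s+u b_n; q′)` on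
`(0, 1)` gives, for every `λ` with `heunV(λ) = q′ + (u b_n − s)(2 + i₀)`, a non-trivial solution
`y = (z_r − x)^{u b_n − s} Σ c_k x^k` of the connection problem at `(ω, m, λ) = (iy, 0, λ)`. -/
theorem hasHeunConnectionSolution_of_candidate {M a Λ : ℝ} (hsub : IsSubextremal M a Λ)
    {s u y : ℝ} {i₀ d : ℕ} (hyc : y = u * surfaceGravity M a Λ (rCosmo M a Λ))
    (hyp : y = (s - 1 - (i₀ : ℝ)) * surfaceGravity M a Λ (rPlus M a Λ))
    (hd : (d : ℝ) = s - 2 - (i₀ : ℝ) - u)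
    {c : ℕ → ℂ} (hc : ∀ k, d + 1 ≤ k → c k = 0) (hc0 : ∃ k, c k ≠ 0) {q : ℂ}
    (hsol : IsSolutionOn (mobiusZr M a Λ : ℂ) ((s + 1 + u * bNeg M a Λ : ℝ) : ℂ) (-(d : ℂ))
      ((2 + (i₀ : ℝ) : ℝ) : ℂ) ((s + u + 1 : ℝ) : ℂ) ((1 - s + u * bNeg M a Λ : ℝ) : ℂ) q (Ioo 0 1)
      (powSum c (d + 1)))
    {lam : ℂ}
    (hV : heunV M a Λ s (I * y) 0 lam = q + (((u * bNeg M a Λ - s) * (2 + (i₀ : ℝ)) : ℝ) : ℂ)) :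
    HasHeunConnectionSolution M a Λ s (I * y) 0 lam := by
  have e1 : heunGamma M a Λ s (I * y) 0 = ((2 + (i₀ : ℝ) : ℝ) : ℂ) :=
    heunGamma_of_resonance hsub hyp
  have hyc' : y = ((s + u) - s) * surfaceGravity M a Λ (rCosmo M a Λ) := by rw [hyc]; ring
  have e2 : heunDelta M a Λ s (I * y) 0 = ((s + u + 1 : ℝ) : ℂ) := heunDelta_of_resonance hsub hyc'
  have e3 : heunEps M a Λ s (I * y) 0 = ((s + 1 - u * bNeg M a Λ : ℝ) : ℂ) :=
    heunEps_of_resonance hsub hyc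
  have e4 := heunSigmaMinus_of_resonance hsub hyc hyp
  refine hasHeunConnectionSolution_of_homotopy (one_lt_mobiusZr hsub) (N := 1 + i₀)
    (p := ((u * bNeg M a Λ - s : ℝ) : ℂ)) (α' := ((s + 1 + u * bNeg M a Λ : ℝ) : ℂ))
    (β' := -(d : ℂ)) ?_ ?_ ?_ (contDiff_powSum c (d + 1)) ?_ (exists_powSum_ne_zero hc hc0)
  · rw [e1]; push_cast; ring
  · rw [e3]; push_cast; ring
  · have hd' : (d : ℂ) = ((s - 2 - (i₀ : ℝ) - u : ℝ) : ℂ) := by rw [← hd]; push_cast; rfl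
    rw [e1, e2, e4, hd']
    unfold heunSigmaPlus
    push_cast
    ring
  · have e5 : heunEps M a Λ s (I * y) 0 + 2 * ((u * bNeg M a Λ - s : ℝ) : ℂ) =
        ((1 - s + u * bNeg M a Λ : ℝ) : ℂ) := by rw [e3]; push_cast; ring
    have e6 : heunV M a Λ s (I * y) 0 lam - ((u * bNeg M a Λ - s : ℝ) : ℂ) *
        heunGamma M a Λ s (I * y) 0 = q := by rw [hV, e1]; push_cast; ring
    rw [e5, e6, e1, e2]
    exact hsol

/-- ★ **STRUCTURE §8 Q3/Q3′ in full, kernel form.** Under the hypotheses of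
`hasHeunConnectionSolution_of_candidate` with `a ≠ 0`, `u > 0`: (1) there is a non-trivial classical
radial Teukolsky solution `R` on `(r₊, r_c)` at `(ω, m, λ) = (iy, 0, λ)`, `Im ω = y > 0`,
"ingoing at `𝓗⁺`" and "outgoing at `𝓗⁺_c`" IN THE SENSE OF THE TREE'S GENERIC-BULLET PREDICATES
`IsIngoingAtEventHorizon` / `IsOutgoingAtCosmoHorizon` (CTdC Def. 3.3 as typed, the reading used by
`RouteW.NonExtremeStrata`; at these resonant points the exponent gap `s + 2B₊ = 1 + i₀ ∈ ℕ` lets the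
cofactor vanish to order `1 + i₀`; on the ray `Re ω = mϖ₁` the typed predicate ≠ the PRINTED bullet
of Def. 3.3 (REFEREE #451 (8), #464): no claim about printed-bullet modes there, nor a physical
quasinormal mode); so every radial hypothesis of `NonExtremeStrata`'s conclusion is met and the
conclusion `R ≡ 0` fails; and (2) the angular half-line hypothesis fails: `Im(λ̄·ω̄) > 0` — the
load-bearing statement: such `λ` is not angular-admissible. -/
theorem doublyResonant_candidate_summary {M a Λ : ℝ} (hsub : IsSubextremal M a Λ) (ha : a ≠ 0)
    {s u y : ℝ} {i₀ d : ℕ} (hu : 0 < u) (hyc : y = u * surfaceGravity M a Λ (rCosmo M a Λ))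
    (hyp : y = (s - 1 - (i₀ : ℝ)) * surfaceGravity M a Λ (rPlus M a Λ))
    (hd : (d : ℝ) = s - 2 - (i₀ : ℝ) - u)
    {c : ℕ → ℂ} (hc : ∀ k, d + 1 ≤ k → c k = 0) (hc0 : ∃ k, c k ≠ 0) {q : ℂ}
    (hsol : IsSolutionOn (mobiusZr M a Λ : ℂ) ((s + 1 + u * bNeg M a Λ : ℝ) : ℂ) (-(d : ℂ))
      ((2 + (i₀ : ℝ) : ℝ) : ℂ) ((s + u + 1 : ℝ) : ℂ) ((1 - s + u * bNeg M a Λ : ℝ) : ℂ) q (Ioo 0 1)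
      (powSum c (d + 1)))
    {lam : ℂ}
    (hV : heunV M a Λ s (I * y) 0 lam = q + (((u * bNeg M a Λ - s) * (2 + (i₀ : ℝ)) : ℝ) : ℂ)) :
    (∃ R : ℝ → ℂ, IsRadialTeukolskySolution M a Λ s (I * y) 0 lam R ∧
        IsIngoingAtEventHorizon M a Λ s (I * y) 0 R ∧ IsOutgoingAtCosmoHorizon M a Λ (I * y) 0 R ∧
        ∃ r ∈ Ioo (rPlus M a Λ) (rCosmo M a Λ), R r ≠ 0) ∧
      0 < (lambdaBar a Λ s (I * y) 0 lam * (starRingEnd ℂ) (I * y)).im :=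
  ⟨radial_of_hasHeunConnectionSolution hsub
      (hasHeunConnectionSolution_of_candidate hsub hyc hyp hd hc hc0 hsol hV),
    im_lambdaBar_mul_conj_pos_of_candidate hsub ha hu (Nat.cast_nonneg i₀) hyc hyp hd hc hc0
      one_pos hsol hV⟩

/-- **Corollary: the candidate's `λ` is never an angular eigenvalue** (for `a > 0`, `2s ∈ ℤ` and
`s ∈ ℤ`, the admissibility of `m = 0`): by the tree's PROVED angular sign lemma
`CasalsTeixeiraDaCosta2022_angularSign_holds` (CTdC Lemma 3.1: angular eigenvalue and `Im ω > 0`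
force `Im(λ̄ω̄) < 0`), incompatible with (2) of `doublyResonant_candidate_summary`. So the
`Im ω > 0` radial solutions of (1) are never Teukolsky MODE solutions. -/
theorem not_isAngularEigenvalue_of_candidate {M a Λ : ℝ} (hsub : IsSubextremal M a Λ) (ha : 0 < a)
    {s u y : ℝ} {i₀ d : ℕ} (hs2 : ∃ k : ℤ, 2 * s = k) (hsZ : ∃ k : ℤ, (0 : ℝ) - s = k) (hu : 0 < u)
    (hyc : y = u * surfaceGravity M a Λ (rCosmo M a Λ))
    (hyp : y = (s - 1 - (i₀ : ℝ)) * surfaceGravity M a Λ (rPlus M a Λ))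
    (hd : (d : ℝ) = s - 2 - (i₀ : ℝ) - u)
    {c : ℕ → ℂ} (hc : ∀ k, d + 1 ≤ k → c k = 0) (hc0 : ∃ k, c k ≠ 0) {q : ℂ}
    (hsol : IsSolutionOn (mobiusZr M a Λ : ℂ) ((s + 1 + u * bNeg M a Λ : ℝ) : ℂ) (-(d : ℂ))
      ((2 + (i₀ : ℝ) : ℝ) : ℂ) ((s + u + 1 : ℝ) : ℂ) ((1 - s + u * bNeg M a Λ : ℝ) : ℂ) q (Ioo 0 1)
      (powSum c (d + 1)))
    {lam : ℂ}
    (hV : heunV M a Λ s (I * y) 0 lam = q + (((u * bNeg M a Λ - s) * (2 + (i₀ : ℝ)) : ℝ) : ℂ)) :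
    ¬IsAngularEigenvalue a Λ s (I * y) 0 lam := by
  intro hang
  have hpos := im_lambdaBar_mul_conj_pos_of_candidate hsub ha.ne' hu (Nat.cast_nonneg i₀) hyc hyp
    hd hc hc0 one_pos hsol hV
  have hy : 0 < y := by rw [hyc]; exact mul_pos hu (surfaceGravity_rCosmo_pos hsub)
  have hω : 0 < (I * (y : ℂ)).im := by simpa using hy
  have hneg := CasalsTeixeiraDaCosta2022_angularSign_holds a Λ s (I * y) 0 lam hsub.2.1 ha hs2 hsZ
    hω hang
  linarith

end Summit.Ventures.KdS.RouteW.DoublyResonant
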